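import Literature.Topology.FourManifolds.SlideSetup1
import HarnessLib

/-!
# The slide set-up, IV: existence of the parameter record

Topic `Literature/Topology/FourManifolds`; fact seat `provefact-IsStrictHandleSlide.isSurgery`
(R. C. Kirby, *The Topology of 4-Manifolds*, LNM 1374 (1989), Ch. I §4, Fig. 4.2; remaining content:
the named fact (S) `Literature.Topology.FourManifolds.FramedLink.IsStrictHandleSlide.slideModel`).
For every band core `c` and every rate `e` smooth and positive on `(1/10, 9/10)` there is a
`SlideChoice c e` (`BandCore.exists_slideChoice`). The constants are chosen in the order
`C_T` (`exists_smoothTransition_deriv_le`) → `e₋, e₊, Me` (`exists_rate_bounds` on `[0.12, 0.88]`) →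
`mΘ, MΘ` (`exists_angle_bounds`) → `μ = min (1/100, θ_low / (8 MΘ + 8))` →
`Mρ = max (Mρlo, Mρup, 1)` → `m_s` (large: the climb) → `N` (large: the bend loss) → `λ` (small:
four constraints) — bundled as a `PreChoice` — and finally `κ_D = 1 / (2 (1 + Σ Aᵢ/Bᵢ))`, which
makes every remaining condition `κ_D · Aᵢ ≤ Bᵢ / 2` (`mul_le_half_of_le`).

## References

* R. C. Kirby, *The Topology of 4-Manifolds*, LNM 1374, Springer (1989), Ch. I §4. [Kirby1989]
-/

open scoped Topology ContDiff
open Set Real Filter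

noncomputable section

namespace Literature.Topology.FourManifolds

/-- **The smallness mechanism**: if `0 ≤ A`, `0 < B`, `A / B ≤ S` and `κ ≤ 1 / (2 (1 + S))` then
`κ A ≤ B / 2`. [folklore] -/
theorem mul_le_half_of_le {κ A B S : ℝ} (hA : 0 ≤ A) (hB : 0 < B) (hS : A / B ≤ S)
    (hκ : κ ≤ 1 / (2 * (1 + S))) : κ * A ≤ B / 2 := by
  have hS0 : 0 ≤ S := (div_nonneg hA hB.le).trans hS
  have h1 : κ * A ≤ A / (2 * (1 + S)) := by
    calc κ * A ≤ 1 / (2 * (1 + S)) * A := mul_le_mul_of_nonneg_right hκ hA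
      _ = A / (2 * (1 + S)) := by ring
  have h2 : A / (2 * (1 + S)) ≤ B / 2 := by
    rw [div_le_div_iff₀ (by linarith) two_pos]
    have : A ≤ B * S := by rwa [div_le_iff₀ hB, mul_comm] at hS
    nlinarith
  exact h1.trans h2

namespace BandCore

variable {A B : Knot} {avoid : Set (Metric.sphere (0 : EuclideanSpace ℝ (Fin 4)) 1)} (c : BandCore A B avoid)

/-- The parameter record without the tip depth (all choices but the last). [folklore] -/
structure PreChoice (e : ℝ → ℝ) where
  CT : ℝ
  CT_ge : ∀ x, deriv smoothTransition x ≤ CT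
  CT_nonneg : 0 ≤ CT
  emin : ℝ
  emax : ℝ
  Me : ℝ
  emin_pos : 0 < emin
  emin_le : emin ≤ emax
  Me_nonneg : 0 ≤ Me
  e_bounds : ∀ h ∈ Icc (0.12 : ℝ) 0.88, emin ≤ e h ∧ e h ≤ emax
  e_deriv : ∀ h ∈ Icc (0.12 : ℝ) 0.88, |deriv e h| ≤ Me
  mΘ : ℝ
  MΘ : ℝ
  mΘ_pos : 0 < mΘ
  mΘ_le : mΘ ≤ MΘ
  Θ_deriv : ∀ h ∈ Icc (0.12 : ℝ) 0.88, -MΘ ≤ deriv c.ΘB h ∧ deriv c.ΘB h ≤ -mΘ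
  μ : ℝ
  μ_pos : 0 < μ
  μ_le : μ ≤ 100⁻¹
  μ_angle : 8 * μ * MΘ ≤ c.θlow
  Mρ : ℝ
  Mρ_pos : 0 < Mρ
  Mρ_geₗ : c.Mρlo CT μ ≤ Mρ
  Mρ_geᵤ : c.Mρup CT μ ≤ Mρ
  ms : ℝ
  ms_geₗ : c.liteMs2 μ_pos ≤ ms
  ms_geᵤ : c.liteMsU2 μ_pos ≤ ms
  climb : c.cmax * emax + 1 ≤ c.qminc * mΘ * ms / 8
  N : ℝ
  N_ge : 2 ≤ N
  Nₗ : (c.cmax * emax + c.cmax * 1 * Me * routeMH' c.liteMH ms CT Mρ / c.liteVmin2 μ_pos +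
      c.qmaxc * MΘ * routeMH' c.liteMH ms CT Mρ / c.liteVmin2 μ_pos) / N < 1
  Nᵤ : (c.cmax * emax + c.cmax * 1 * Me * routeMH' c.liteMHU ms CT Mρ / c.liteVminU2 μ_pos +
      c.qmaxc * MΘ * routeMH' c.liteMHU ms CT Mρ / c.liteVminU2 μ_pos) / N < 1
  lam : ℝ
  lam_pos : 0 < lam
  lam_leₗ : lam * c.liteMH ≤ c.liteVmin2 μ_pos * emin / 2
  lam_leᵤ : lam * c.liteMHU ≤ c.liteVminU2 μ_pos * emin / 2
  lam_gentle : (1 + CT) * lam * (c.cmax + 1) ≤ c.qminc * mΘ / 2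
  lam_clamp : lam * (emin / (4 * (Mρ * emax + Me)) + 2 * c.cmax * emax / (c.qminc * mΘ)) ≤ 3 * emin / 8

variable {e : ℝ → ℝ}

/-- **Stage A: the constants and the first four parameters exist.** [folklore] -/
theorem exists_preChoice (he : ContDiffOn ℝ ∞ e (Ioo (10⁻¹ : ℝ) (9 / 10)))
    (hpos : ∀ h ∈ Ioo (10⁻¹ : ℝ) (9 / 10), 0 < e h) : Nonempty (c.PreChoice e) := by
  obtain ⟨CT, hCT0, hCT⟩ := exists_smoothTransition_deriv_le
  obtain ⟨emin, emax, Me, hemin, heminmax, hMe0, hebd, hed⟩ :=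
    exists_rate_bounds he hpos (w₁ := 0.12) (w₂ := 0.88) (by norm_num) (by norm_num) (by norm_num)
  have hemax : 0 < emax := hemin.trans_le heminmax
  obtain ⟨mΘ, MΘ, hmΘ, hmM, hΘbd⟩ := c.exists_angle_bounds (w₁ := 0.12) (w₂ := 0.88) (by norm_num) (by norm_num) (by norm_num)
  have hMΘ : 0 < MΘ := hmΘ.trans_le hmM
  have hθlow := c.θlow_pos
  -- `μ`
  obtain ⟨μ, hμdef⟩ : ∃ μ : ℝ, μ = min 100⁻¹ (c.θlow / (8 * MΘ + 8)) := ⟨_, rfl⟩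
  have hμpos : 0 < μ := by rw [hμdef]; exact lt_min (by norm_num) (div_pos hθlow (by linarith))
  have hμle : μ ≤ 100⁻¹ := by rw [hμdef]; exact min_le_left _ _
  have hμangle : 8 * μ * MΘ ≤ c.θlow := by
    have h1 : μ ≤ c.θlow / (8 * MΘ + 8) := by rw [hμdef]; exact min_le_right _ _
    rw [le_div_iff₀ (by linarith)] at h1
    nlinarith [hμpos.le, hMΘ.le]
  -- `Mρ`
  obtain ⟨Mρ, hMρdef⟩ : ∃ M : ℝ, M = max (max (c.Mρlo CT μ) (c.Mρup CT μ)) 1 := ⟨_, rfl⟩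
  have hMρ1 : 1 ≤ Mρ := by rw [hMρdef]; exact le_max_right _ _
  have hMρpos : 0 < Mρ := by linarith
  have hMρl : c.Mρlo CT μ ≤ Mρ := by rw [hMρdef]; exact (le_max_left _ _).trans (le_max_left _ _)
  have hMρu : c.Mρup CT μ ≤ Mρ := by rw [hMρdef]; exact (le_max_right _ _).trans (le_max_left _ _)
  have hvl := (c.liteVmin2_spec hμpos).1
  have hvu := (c.liteVminU2_spec hμpos).1
  have hMHl := c.liteMH_pos
  have hMHu := c.liteMHU_pos
  have hcmax := c.cmax_nonneg
  have hqmin := c.qminc_pos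
  have hqmax := c.qmaxc_pos
  -- `m_s`
  obtain ⟨ms, hmsdef⟩ : ∃ m : ℝ, m = max (max (c.liteMs2 hμpos) (c.liteMsU2 hμpos)) (8 * (c.cmax * emax + 1) / (c.qminc * mΘ)) :=
    ⟨_, rfl⟩
  have hmsl : c.liteMs2 hμpos ≤ ms := by rw [hmsdef]; exact (le_max_left _ _).trans (le_max_left _ _)
  have hmsu : c.liteMsU2 hμpos ≤ ms := by rw [hmsdef]; exact (le_max_right _ _).trans (le_max_left _ _)
  have hmspos : 0 < ms := (c.liteMs2_pos hμpos).trans_le hmsl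
  have hclimb : c.cmax * emax + 1 ≤ c.qminc * mΘ * ms / 8 := by
    have h1 : 8 * (c.cmax * emax + 1) / (c.qminc * mΘ) ≤ ms := by rw [hmsdef]; exact le_max_right _ _
    rw [div_le_iff₀ (mul_pos hqmin hmΘ)] at h1
    have : 0 < c.qminc * mΘ := mul_pos hqmin hmΘ
    nlinarith
  -- `N`
  obtain ⟨L1l, hL1ldef⟩ : ∃ L : ℝ, L = c.cmax * emax + c.cmax * 1 * Me * routeMH' c.liteMH ms CT Mρ / c.liteVmin2 hμpos +
      c.qmaxc * MΘ * routeMH' c.liteMH ms CT Mρ / c.liteVmin2 hμpos := ⟨_, rfl⟩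
  obtain ⟨L1u, hL1udef⟩ : ∃ L : ℝ, L = c.cmax * emax + c.cmax * 1 * Me * routeMH' c.liteMHU ms CT Mρ / c.liteVminU2 hμpos +
      c.qmaxc * MΘ * routeMH' c.liteMHU ms CT Mρ / c.liteVminU2 hμpos := ⟨_, rfl⟩
  have hMH'l : 0 < routeMH' c.liteMH ms CT Mρ := by rw [routeMH']; positivity
  have hMH'u : 0 < routeMH' c.liteMHU ms CT Mρ := by rw [routeMH']; positivity
  have hL1l : 0 ≤ L1l := by rw [hL1ldef]; positivity
  have hL1u : 0 ≤ L1u := by rw [hL1udef]; positivity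
  obtain ⟨N, hNdef⟩ : ∃ n : ℝ, n = max 2 (max L1l L1u + 1) := ⟨_, rfl⟩
  have hN2 : 2 ≤ N := by rw [hNdef]; exact le_max_left _ _
  have hNpos : 0 < N := by linarith
  have hNge : max L1l L1u + 1 ≤ N := by rw [hNdef]; exact le_max_right _ _
  have hNl : L1l / N < 1 := by rw [div_lt_one hNpos]; linarith [le_max_left L1l L1u]
  have hNu : L1u / N < 1 := by rw [div_lt_one hNpos]; linarith [le_max_right L1l L1u]
  -- `λ`
  obtain ⟨Z, hZdef⟩ : ∃ z : ℝ, z = emin / (4 * (Mρ * emax + Me)) + 2 * c.cmax * emax / (c.qminc * mΘ) := ⟨_, rfl⟩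
  have hsmax : 0 < Mρ * emax + Me := by positivity
  have hZ : 0 < Z := by
    rw [hZdef]
    have : 0 < emin / (4 * (Mρ * emax + Me)) := div_pos hemin (by linarith)
    have : 0 ≤ 2 * c.cmax * emax / (c.qminc * mΘ) := by positivity
    linarith
  obtain ⟨lam, hlamdef⟩ : ∃ l : ℝ, l = min (min (c.liteVmin2 hμpos * emin / (2 * c.liteMH)) (c.liteVminU2 hμpos * emin / (2 * c.liteMHU)))
      (min (c.qminc * mΘ / (2 * (1 + CT) * (c.cmax + 1))) (3 * emin / 8 / Z)) := ⟨_, rfl⟩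
  have hlampos : 0 < lam := by
    rw [hlamdef]
    refine lt_min (lt_min ?_ ?_) (lt_min ?_ ?_)
    · exact div_pos (mul_pos hvl hemin) (by linarith)
    · exact div_pos (mul_pos hvu hemin) (by linarith)
    · exact div_pos (mul_pos hqmin hmΘ) (by positivity)
    · exact div_pos (by linarith) hZ
  have hlam1 : lam * c.liteMH ≤ c.liteVmin2 hμpos * emin / 2 := by
    have h' : lam ≤ c.liteVmin2 hμpos * emin / (2 * c.liteMH) := by rw [hlamdef]; exact (min_le_left _ _).trans (min_le_left _ _)
    rw [le_div_iff₀ (by linarith)] at h'; linarith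
  have hlam2 : lam * c.liteMHU ≤ c.liteVminU2 hμpos * emin / 2 := by
    have h' : lam ≤ c.liteVminU2 hμpos * emin / (2 * c.liteMHU) := by rw [hlamdef]; exact (min_le_left _ _).trans (min_le_right _ _)
    rw [le_div_iff₀ (by linarith)] at h'; linarith
  have hlam3 : (1 + CT) * lam * (c.cmax + 1) ≤ c.qminc * mΘ / 2 := by
    have h' : lam ≤ c.qminc * mΘ / (2 * (1 + CT) * (c.cmax + 1)) := by rw [hlamdef]; exact (min_le_right _ _).trans (min_le_left _ _)
    have hd : 0 < 2 * (1 + CT) * (c.cmax + 1) := by positivity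
    rw [le_div_iff₀ hd] at h'; linarith
  have hlam4 : lam * Z ≤ 3 * emin / 8 := by
    have h' : lam ≤ 3 * emin / 8 / Z := by rw [hlamdef]; exact (min_le_right _ _).trans (min_le_right _ _)
    rwa [le_div_iff₀ hZ] at h'
  refine ⟨⟨CT, hCT, hCT0, emin, emax, Me, hemin, heminmax, hMe0, hebd, hed, mΘ, MΘ, hmΘ, hmM, hΘbd, μ, hμpos, hμle,
    hμangle, Mρ, hMρpos, hMρl, hMρu, ms, hmsl, hmsu, hclimb, N, hN2, ?_, ?_, lam, hlampos, hlam1, hlam2, hlam3, ?_⟩⟩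
  · rw [← hL1ldef]; exact hNl
  · rw [← hL1udef]; exact hNu
  · rw [← hZdef]; exact hlam4

namespace PreChoice

variable {c} {e : ℝ → ℝ} (Q : c.PreChoice e)

/-- `emax_pos` (auxiliary). [folklore] -/
theorem emax_pos : 0 < Q.emax := Q.emin_pos.trans_le Q.emin_le
/-- `MΘ_pos` (auxiliary). [folklore] -/
theorem MΘ_pos : 0 < Q.MΘ := Q.mΘ_pos.trans_le Q.mΘ_le
/-- `ms_pos` (auxiliary). [folklore] -/
theorem ms_pos : 0 < Q.ms := (c.liteMs2_pos Q.μ_pos).trans_le Q.ms_geₗ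
/-- `N_pos` (auxiliary). [folklore] -/
theorem N_pos : 0 < Q.N := by linarith [Q.N_ge]
/-- `MH'ₗ_pos` (auxiliary). [folklore] -/
theorem MH'ₗ_pos : 0 < routeMH' c.liteMH Q.ms Q.CT Q.Mρ := by
  rw [routeMH']; have := c.liteMH_pos; have := Q.ms_pos; have := Q.CT_nonneg; have := Q.Mρ_pos; positivity
/-- `MH'ᵤ_pos` (auxiliary). [folklore] -/
theorem MH'ᵤ_pos : 0 < routeMH' c.liteMHU Q.ms Q.CT Q.Mρ := by
  rw [routeMH']; have := c.liteMHU_pos; have := Q.ms_pos; have := Q.CT_nonneg; have := Q.Mρ_pos; positivity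
/-- `smax_pos` (auxiliary). [folklore] -/
theorem smax_pos : 0 < Q.Mρ * Q.emax + Q.Me := by have := Q.Mρ_pos; have := Q.emax_pos; have := Q.Me_nonneg; positivity
/-- `Z_nonneg` (auxiliary). [folklore] -/
theorem Z_nonneg : 0 ≤ Q.emin / (4 * (Q.Mρ * Q.emax + Q.Me)) + 2 * c.cmax * Q.emax / (c.qminc * Q.mΘ) := by
  have := Q.smax_pos; have := Q.emin_pos; have := Q.emax_pos; have := c.cmax_nonneg; have := c.qminc_pos; have := Q.mΘ_pos
  positivity

/-- **The tip depth** `κ_D = minᵢ 1 / (2 (1 + Aᵢ/Bᵢ))` over the conditions of the `SlideChoice`. [folklore] -/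
def κD : ℝ := min (1 / (2 * (1 + (1) / (liteKmaxGen Q.ms)))) (min (1 / (2 * (1 + (1) / (1)))) (min (1 / (2 * (1 + (3 * Q.ms) / (Q.μ)))) (min (1 / (2 * (1 + (Q.emax) / (Q.emin)))) (min (1 / (2 * (1 + (Q.emax) / (1)))) (min (1 / (2 * (1 + (2 * Q.Me * c.liteMH) / (c.liteVmin2 Q.μ_pos * Q.emin)))) (min (1 / (2 * (1 + (2 * Q.Me * c.liteMHU) / (c.liteVminU2 Q.μ_pos * Q.emin)))) (min (1 / (2 * (1 + (2 * Q.Me * routeMH' c.liteMH Q.ms Q.CT Q.Mρ) / (c.liteVmin2 Q.μ_pos * Q.emin)))) (min (1 / (2 * (1 + (2 * Q.Me * routeMH' c.liteMHU Q.ms Q.CT Q.Mρ) / (c.liteVminU2 Q.μ_pos * Q.emin)))) (min (1 / (2 * (1 + (c.cmax * Q.emax + c.qmaxc * Q.MΘ * routeMH' c.liteMH Q.ms Q.CT Q.Mρ / c.liteVmin2 Q.μ_pos) / (2⁻¹)))) (min (1 / (2 * (1 + (c.cmax * Q.emax + c.qmaxc * Q.MΘ * routeMH' c.liteMHU Q.ms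 Q.CT Q.Mρ / c.liteVminU2 Q.μ_pos) / (2⁻¹)))) (min (1 / (2 * (1 + (4 * c.cmax * (c.cmax * Q.emax + c.qmaxc * Q.MΘ * routeMH' c.liteMH Q.ms Q.CT Q.Mρ / c.liteVmin2 Q.μ_pos)) / (1)))) (min (1 / (2 * (1 + (4 * c.cmax * (c.cmax * Q.emax + c.qmaxc * Q.MΘ * routeMH' c.liteMHU Q.ms Q.CT Q.Mρ / c.liteVminU2 Q.μ_pos)) / (1)))) (min (1 / (2 * (1 + (16 * (c.qmaxc * Q.MΘ * routeMH' c.liteMH Q.ms Q.CT Q.Mρ) * (c.cmax * Q.emax + c.qmaxc * Q.MΘ * routeMH' c.liteMH Q.ms Q.CT Q.Mρ / c.liteVmin2 Q.μ_pos)) / (c.liteVmin2 Q.μ_pos * Q.emin)))) (min (1 / (2 * (1 + (16 * (c.qmaxc * Q.MΘ * routeMH' c.liteMHU Q.ms Q.CT Q.Mρ) * (c.cmax * Q.emax + c.qmaxc * Q.MΘ * routeMH' c.liteMHU Q.ms Q.CT Q.Mρ / c.liteVminU2 Q.μ_pos)) / (c.liteVminU2 Q.μ_pos * Q.emin)))) (min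 (1 / (2 * (1 + (Q.MΘ * (Q.emin / (4 * (Q.Mρ * Q.emax + Q.Me)) + 2 * c.cmax * Q.emax / (c.qminc * Q.mΘ))) / (c.θlow / 2)))) (min (1 / (2 * (1 + (2 * Q.MΘ * Q.emax) / (Q.lam * c.θlow)))) (min (1 / (2 * (1 + (20 * Q.emax) / (Q.lam)))) (min (1 / (2 * (1 + (Q.emin / (4 * (Q.Mρ * Q.emax + Q.Me))) / (100⁻¹)))) (min (1 / (2 * (1 + (c.cmax * Q.emax + c.QF * Q.MΘ * (Q.emin / (4 * (Q.Mρ * Q.emax + Q.Me)) + 2 * c.cmax * Q.emax / (c.qminc * Q.mΘ))) / (2⁻¹)))) (min (1 / (2 * (1 + (8 * c.cmax * (c.cmax * Q.emax + c.QF * Q.MΘ * (Q.emin / (4 * (Q.Mρ * Q.emax + Q.Me)) + 2 * c.cmax * Q.emax / (c.qminc * Q.mΘ)))) / (1)))) (1 / (2 * (1 + (16 * (c.QF * Q.MΘ) * (c.cmax * Q.emax + c.QF * Q.MΘ * (Q.emin / (4 * (Q.Mρ * Q.emax + Q.Me)) + 2 * c.cmax * Q.emax / (c.qminc * Q.mΘ))))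 / (Q.lam))))))))))))))))))))))))

/-- `κD_def` (auxiliary). [folklore] -/
theorem κD_def : Q.κD = min (1 / (2 * (1 + (1) / (liteKmaxGen Q.ms)))) (min (1 / (2 * (1 + (1) / (1)))) (min (1 / (2 * (1 + (3 * Q.ms) / (Q.μ)))) (min (1 / (2 * (1 + (Q.emax) / (Q.emin)))) (min (1 / (2 * (1 + (Q.emax) / (1)))) (min (1 / (2 * (1 + (2 * Q.Me * c.liteMH) / (c.liteVmin2 Q.μ_pos * Q.emin)))) (min (1 / (2 * (1 + (2 * Q.Me * c.liteMHU) / (c.liteVminU2 Q.μ_pos * Q.emin)))) (min (1 / (2 * (1 + (2 * Q.Me * routeMH' c.liteMH Q.ms Q.CT Q.Mρ) / (c.liteVmin2 Q.μ_pos * Q.emin)))) (min (1 / (2 * (1 + (2 * Q.Me * routeMH' c.liteMHU Q.ms Q.CT Q.Mρ) / (c.liteVminU2 Q.μ_pos * Q.emin)))) (min (1 / (2 * (1 + (c.cmax * Q.emax + c.qmaxc * Q.MΘ * routeMH' c.liteMH Q.ms Q.CT Q.Mρ / c.liteVmin2 Q.μ_pos) / (2⁻¹)))) (min (1 / (2 *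 (1 + (c.cmax * Q.emax + c.qmaxc * Q.MΘ * routeMH' c.liteMHU Q.ms Q.CT Q.Mρ / c.liteVminU2 Q.μ_pos) / (2⁻¹)))) (min (1 / (2 * (1 + (4 * c.cmax * (c.cmax * Q.emax + c.qmaxc * Q.MΘ * routeMH' c.liteMH Q.ms Q.CT Q.Mρ / c.liteVmin2 Q.μ_pos)) / (1)))) (min (1 / (2 * (1 + (4 * c.cmax * (c.cmax * Q.emax + c.qmaxc * Q.MΘ * routeMH' c.liteMHU Q.ms Q.CT Q.Mρ / c.liteVminU2 Q.μ_pos)) / (1)))) (min (1 / (2 * (1 + (16 * (c.qmaxc * Q.MΘ * routeMH' c.liteMH Q.ms Q.CT Q.Mρ) * (c.cmax * Q.emax + c.qmaxc * Q.MΘ * routeMH' c.liteMH Q.ms Q.CT Q.Mρ / c.liteVmin2 Q.μ_pos)) / (c.liteVmin2 Q.μ_pos * Q.emin)))) (min (1 / (2 * (1 + (16 * (c.qmaxc * Q.MΘ * routeMH' c.liteMHU Q.ms Q.CT Q.Mρ) * (c.cmax * Q.emax + c.qmaxc * Q.MΘ * routeMH' c.liteMHU Q.ms Q.CT Q.Mρ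 / c.liteVminU2 Q.μ_pos)) / (c.liteVminU2 Q.μ_pos * Q.emin)))) (min (1 / (2 * (1 + (Q.MΘ * (Q.emin / (4 * (Q.Mρ * Q.emax + Q.Me)) + 2 * c.cmax * Q.emax / (c.qminc * Q.mΘ))) / (c.θlow / 2)))) (min (1 / (2 * (1 + (2 * Q.MΘ * Q.emax) / (Q.lam * c.θlow)))) (min (1 / (2 * (1 + (20 * Q.emax) / (Q.lam)))) (min (1 / (2 * (1 + (Q.emin / (4 * (Q.Mρ * Q.emax + Q.Me))) / (100⁻¹)))) (min (1 / (2 * (1 + (c.cmax * Q.emax + c.QF * Q.MΘ * (Q.emin / (4 * (Q.Mρ * Q.emax + Q.Me)) + 2 * c.cmax * Q.emax / (c.qminc * Q.mΘ))) / (2⁻¹)))) (min (1 / (2 * (1 + (8 * c.cmax * (c.cmax * Q.emax + c.QF * Q.MΘ * (Q.emin / (4 * (Q.Mρ * Q.emax + Q.Me)) + 2 * c.cmax * Q.emax / (c.qminc * Q.mΘ)))) / (1)))) (1 / (2 * (1 + (16 * (c.QF * Q.MΘ) * (c.cmax * Q.emax + c.QF * Q.MΘ * (Q.emin / (4 * (Q.Mρ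 * Q.emax + Q.Me)) + 2 * c.cmax * Q.emax / (c.qminc * Q.mΘ)))) / (Q.lam)))))))))))))))))))))))) := rfl

/-- `κD_le_bound_k` (auxiliary). [folklore] -/
theorem κD_le_bound_k : Q.κD ≤ 1 / (2 * (1 + (1) / (liteKmaxGen Q.ms))) := by
  rw [κD_def]
  exact min_le_left _ _

/-- `κD_le_bound_one` (auxiliary). [folklore] -/
theorem κD_le_bound_one : Q.κD ≤ 1 / (2 * (1 + (1) / (1))) := by
  rw [κD_def]
  exact (min_le_right _ _).trans (min_le_left _ _)

/-- `κD_le_bound_mu` (auxiliary). [folklore] -/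
theorem κD_le_bound_mu : Q.κD ≤ 1 / (2 * (1 + (3 * Q.ms) / (Q.μ))) := by
  rw [κD_def]
  exact (min_le_right _ _).trans ((min_le_right _ _).trans (min_le_left _ _))

/-- `κD_le_bound_e1` (auxiliary). [folklore] -/
theorem κD_le_bound_e1 : Q.κD ≤ 1 / (2 * (1 + (Q.emax) / (Q.emin))) := by
  rw [κD_def]
  exact (min_le_right _ _).trans ((min_le_right _ _).trans ((min_le_right _ _).trans (min_le_left _ _)))

/-- `κD_le_bound_e2` (auxiliary). [folklore] -/
theorem κD_le_bound_e2 : Q.κD ≤ 1 / (2 * (1 + (Q.emax) / (1))) := by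
  rw [κD_def]
  exact (min_le_right _ _).trans ((min_le_right _ _).trans ((min_le_right _ _).trans ((min_le_right _ _).trans (min_le_left _ _))))

/-- `κD_le_bound_Mel` (auxiliary). [folklore] -/
theorem κD_le_bound_Mel : Q.κD ≤ 1 / (2 * (1 + (2 * Q.Me * c.liteMH) / (c.liteVmin2 Q.μ_pos * Q.emin))) := by
  rw [κD_def]
  exact (min_le_right _ _).trans ((min_le_right _ _).trans ((min_le_right _ _).trans ((min_le_right _ _).trans ((min_le_right _ _).trans (min_le_left _ _)))))

/-- `κD_le_bound_Meu` (auxiliary). [folklore] -/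
theorem κD_le_bound_Meu : Q.κD ≤ 1 / (2 * (1 + (2 * Q.Me * c.liteMHU) / (c.liteVminU2 Q.μ_pos * Q.emin))) := by
  rw [κD_def]
  exact (min_le_right _ _).trans ((min_le_right _ _).trans ((min_le_right _ _).trans ((min_le_right _ _).trans ((min_le_right _ _).trans ((min_le_right _ _).trans (min_le_left _ _))))))

/-- `κD_le_bound_c1l` (auxiliary). [folklore] -/
theorem κD_le_bound_c1l : Q.κD ≤ 1 / (2 * (1 + (2 * Q.Me * routeMH' c.liteMH Q.ms Q.CT Q.Mρ) / (c.liteVmin2 Q.μ_pos * Q.emin))) := by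
  rw [κD_def]
  exact (min_le_right _ _).trans ((min_le_right _ _).trans ((min_le_right _ _).trans ((min_le_right _ _).trans ((min_le_right _ _).trans ((min_le_right _ _).trans ((min_le_right _ _).trans (min_le_left _ _)))))))

/-- `κD_le_bound_c1u` (auxiliary). [folklore] -/
theorem κD_le_bound_c1u : Q.κD ≤ 1 / (2 * (1 + (2 * Q.Me * routeMH' c.liteMHU Q.ms Q.CT Q.Mρ) / (c.liteVminU2 Q.μ_pos * Q.emin))) := by
  rw [κD_def]
  exact (min_le_right _ _).trans ((min_le_right _ _).trans ((min_le_right _ _).trans ((min_le_right _ _).trans ((min_le_right _ _).trans ((min_le_right _ _).trans ((min_le_right _ _).trans ((min_le_right _ _).trans (min_le_left _ _))))))))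

/-- `κD_le_bound_csl` (auxiliary). [folklore] -/
theorem κD_le_bound_csl : Q.κD ≤ 1 / (2 * (1 + (c.cmax * Q.emax + c.qmaxc * Q.MΘ * routeMH' c.liteMH Q.ms Q.CT Q.Mρ / c.liteVmin2 Q.μ_pos) / (2⁻¹))) := by
  rw [κD_def]
  exact (min_le_right _ _).trans ((min_le_right _ _).trans ((min_le_right _ _).trans ((min_le_right _ _).trans ((min_le_right _ _).trans ((min_le_right _ _).trans ((min_le_right _ _).trans ((min_le_right _ _).trans ((min_le_right _ _).trans (min_le_left _ _)))))))))

/-- `κD_le_bound_csu` (auxiliary). [folklore] -/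
theorem κD_le_bound_csu : Q.κD ≤ 1 / (2 * (1 + (c.cmax * Q.emax + c.qmaxc * Q.MΘ * routeMH' c.liteMHU Q.ms Q.CT Q.Mρ / c.liteVminU2 Q.μ_pos) / (2⁻¹))) := by
  rw [κD_def]
  exact (min_le_right _ _).trans ((min_le_right _ _).trans ((min_le_right _ _).trans ((min_le_right _ _).trans ((min_le_right _ _).trans ((min_le_right _ _).trans ((min_le_right _ _).trans ((min_le_right _ _).trans ((min_le_right _ _).trans ((min_le_right _ _).trans (min_le_left _ _))))))))))

/-- `κD_le_bound_c2l` (auxiliary). [folklore] -/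
theorem κD_le_bound_c2l : Q.κD ≤ 1 / (2 * (1 + (4 * c.cmax * (c.cmax * Q.emax + c.qmaxc * Q.MΘ * routeMH' c.liteMH Q.ms Q.CT Q.Mρ / c.liteVmin2 Q.μ_pos)) / (1))) := by
  rw [κD_def]
  exact (min_le_right _ _).trans ((min_le_right _ _).trans ((min_le_right _ _).trans ((min_le_right _ _).trans ((min_le_right _ _).trans ((min_le_right _ _).trans ((min_le_right _ _).trans ((min_le_right _ _).trans ((min_le_right _ _).trans ((min_le_right _ _).trans ((min_le_right _ _).trans (min_le_left _ _)))))))))))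

/-- `κD_le_bound_c2u` (auxiliary). [folklore] -/
theorem κD_le_bound_c2u : Q.κD ≤ 1 / (2 * (1 + (4 * c.cmax * (c.cmax * Q.emax + c.qmaxc * Q.MΘ * routeMH' c.liteMHU Q.ms Q.CT Q.Mρ / c.liteVminU2 Q.μ_pos)) / (1))) := by
  rw [κD_def]
  exact (min_le_right _ _).trans ((min_le_right _ _).trans ((min_le_right _ _).trans ((min_le_right _ _).trans ((min_le_right _ _).trans ((min_le_right _ _).trans ((min_le_right _ _).trans ((min_le_right _ _).trans ((min_le_right _ _).trans ((min_le_right _ _).trans ((min_le_right _ _).trans ((min_le_right _ _).trans (min_le_left _ _))))))))))))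

/-- `κD_le_bound_c3l` (auxiliary). [folklore] -/
theorem κD_le_bound_c3l : Q.κD ≤ 1 / (2 * (1 + (16 * (c.qmaxc * Q.MΘ * routeMH' c.liteMH Q.ms Q.CT Q.Mρ) * (c.cmax * Q.emax + c.qmaxc * Q.MΘ * routeMH' c.liteMH Q.ms Q.CT Q.Mρ / c.liteVmin2 Q.μ_pos)) / (c.liteVmin2 Q.μ_pos * Q.emin))) := by
  rw [κD_def]
  exact (min_le_right _ _).trans ((min_le_right _ _).trans ((min_le_right _ _).trans ((min_le_right _ _).trans ((min_le_right _ _).trans ((min_le_right _ _).trans ((min_le_right _ _).trans ((min_le_right _ _).trans ((min_le_right _ _).trans ((min_le_right _ _).trans ((min_le_right _ _).trans ((min_le_right _ _).trans ((min_le_right _ _).trans (min_le_left _ _)))))))))))))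

/-- `κD_le_bound_c3u` (auxiliary). [folklore] -/
theorem κD_le_bound_c3u : Q.κD ≤ 1 / (2 * (1 + (16 * (c.qmaxc * Q.MΘ * routeMH' c.liteMHU Q.ms Q.CT Q.Mρ) * (c.cmax * Q.emax + c.qmaxc * Q.MΘ * routeMH' c.liteMHU Q.ms Q.CT Q.Mρ / c.liteVminU2 Q.μ_pos)) / (c.liteVminU2 Q.μ_pos * Q.emin))) := by
  rw [κD_def]
  exact (min_le_right _ _).trans ((min_le_right _ _).trans ((min_le_right _ _).trans ((min_le_right _ _).trans ((min_le_right _ _).trans ((min_le_right _ _).trans ((min_le_right _ _).trans ((min_le_right _ _).trans ((min_le_right _ _).trans ((min_le_right _ _).trans ((min_le_right _ _).trans ((min_le_right _ _).trans ((min_le_right _ _).trans ((min_le_right _ _).trans (min_le_left _ _))))))))))))))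

/-- `κD_le_bound_fA` (auxiliary). [folklore] -/
theorem κD_le_bound_fA : Q.κD ≤ 1 / (2 * (1 + (Q.MΘ * (Q.emin / (4 * (Q.Mρ * Q.emax + Q.Me)) + 2 * c.cmax * Q.emax / (c.qminc * Q.mΘ))) / (c.θlow / 2))) := by
  rw [κD_def]
  exact (min_le_right _ _).trans ((min_le_right _ _).trans ((min_le_right _ _).trans ((min_le_right _ _).trans ((min_le_right _ _).trans ((min_le_right _ _).trans ((min_le_right _ _).trans ((min_le_right _ _).trans ((min_le_right _ _).trans ((min_le_right _ _).trans ((min_le_right _ _).trans ((min_le_right _ _).trans ((min_le_right _ _).trans ((min_le_right _ _).trans ((min_le_right _ _).trans (min_le_left _ _)))))))))))))))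

/-- `κD_le_bound_fB` (auxiliary). [folklore] -/
theorem κD_le_bound_fB : Q.κD ≤ 1 / (2 * (1 + (2 * Q.MΘ * Q.emax) / (Q.lam * c.θlow))) := by
  rw [κD_def]
  exact (min_le_right _ _).trans ((min_le_right _ _).trans ((min_le_right _ _).trans ((min_le_right _ _).trans ((min_le_right _ _).trans ((min_le_right _ _).trans ((min_le_right _ _).trans ((min_le_right _ _).trans ((min_le_right _ _).trans ((min_le_right _ _).trans ((min_le_right _ _).trans ((min_le_right _ _).trans ((min_le_right _ _).trans ((min_le_right _ _).trans ((min_le_right _ _).trans ((min_le_right _ _).trans (min_le_left _ _))))))))))))))))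

/-- `κD_le_bound_fM` (auxiliary). [folklore] -/
theorem κD_le_bound_fM : Q.κD ≤ 1 / (2 * (1 + (20 * Q.emax) / (Q.lam))) := by
  rw [κD_def]
  exact (min_le_right _ _).trans ((min_le_right _ _).trans ((min_le_right _ _).trans ((min_le_right _ _).trans ((min_le_right _ _).trans ((min_le_right _ _).trans ((min_le_right _ _).trans ((min_le_right _ _).trans ((min_le_right _ _).trans ((min_le_right _ _).trans ((min_le_right _ _).trans ((min_le_right _ _).trans ((min_le_right _ _).trans ((min_le_right _ _).trans ((min_le_right _ _).trans ((min_le_right _ _).trans ((min_le_right _ _).trans (min_le_left _ _)))))))))))))))))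

/-- `κD_le_bound_bs` (auxiliary). [folklore] -/
theorem κD_le_bound_bs : Q.κD ≤ 1 / (2 * (1 + (Q.emin / (4 * (Q.Mρ * Q.emax + Q.Me))) / (100⁻¹))) := by
  rw [κD_def]
  exact (min_le_right _ _).trans ((min_le_right _ _).trans ((min_le_right _ _).trans ((min_le_right _ _).trans ((min_le_right _ _).trans ((min_le_right _ _).trans ((min_le_right _ _).trans ((min_le_right _ _).trans ((min_le_right _ _).trans ((min_le_right _ _).trans ((min_le_right _ _).trans ((min_le_right _ _).trans ((min_le_right _ _).trans ((min_le_right _ _).trans ((min_le_right _ _).trans ((min_le_right _ _).trans ((min_le_right _ _).trans ((min_le_right _ _).trans (min_le_left _ _))))))))))))))))))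

/-- `κD_le_bound_F1` (auxiliary). [folklore] -/
theorem κD_le_bound_F1 : Q.κD ≤ 1 / (2 * (1 + (c.cmax * Q.emax + c.QF * Q.MΘ * (Q.emin / (4 * (Q.Mρ * Q.emax + Q.Me)) + 2 * c.cmax * Q.emax / (c.qminc * Q.mΘ))) / (2⁻¹))) := by
  rw [κD_def]
  exact (min_le_right _ _).trans ((min_le_right _ _).trans ((min_le_right _ _).trans ((min_le_right _ _).trans ((min_le_right _ _).trans ((min_le_right _ _).trans ((min_le_right _ _).trans ((min_le_right _ _).trans ((min_le_right _ _).trans ((min_le_right _ _).trans ((min_le_right _ _).trans ((min_le_right _ _).trans ((min_le_right _ _).trans ((min_le_right _ _).trans ((min_le_right _ _).trans ((min_le_right _ _).trans ((min_le_right _ _).trans ((min_le_right _ _).trans ((min_le_right _ _).trans (min_le_left _ _)))))))))))))))))))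

/-- `κD_le_bound_F1p` (auxiliary). [folklore] -/
theorem κD_le_bound_F1p : Q.κD ≤ 1 / (2 * (1 + (8 * c.cmax * (c.cmax * Q.emax + c.QF * Q.MΘ * (Q.emin / (4 * (Q.Mρ * Q.emax + Q.Me)) + 2 * c.cmax * Q.emax / (c.qminc * Q.mΘ)))) / (1))) := by
  rw [κD_def]
  exact (min_le_right _ _).trans ((min_le_right _ _).trans ((min_le_right _ _).trans ((min_le_right _ _).trans ((min_le_right _ _).trans ((min_le_right _ _).trans ((min_le_right _ _).trans ((min_le_right _ _).trans ((min_le_right _ _).trans ((min_le_right _ _).trans ((min_le_right _ _).trans ((min_le_right _ _).trans ((min_le_right _ _).trans ((min_le_right _ _).trans ((min_le_right _ _).trans ((min_le_right _ _).trans ((min_le_right _ _).trans ((min_le_right _ _).trans ((min_le_right _ _).trans ((min_le_right _ _).trans (min_le_left _ _))))))))))))))))))))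

/-- `κD_le_bound_F2` (auxiliary). [folklore] -/
theorem κD_le_bound_F2 : Q.κD ≤ 1 / (2 * (1 + (16 * (c.QF * Q.MΘ) * (c.cmax * Q.emax + c.QF * Q.MΘ * (Q.emin / (4 * (Q.Mρ * Q.emax + Q.Me)) + 2 * c.cmax * Q.emax / (c.qminc * Q.mΘ)))) / (Q.lam))) := by
  rw [κD_def]
  exact (min_le_right _ _).trans ((min_le_right _ _).trans ((min_le_right _ _).trans ((min_le_right _ _).trans ((min_le_right _ _).trans ((min_le_right _ _).trans ((min_le_right _ _).trans ((min_le_right _ _).trans ((min_le_right _ _).trans ((min_le_right _ _).trans ((min_le_right _ _).trans ((min_le_right _ _).trans ((min_le_right _ _).trans ((min_le_right _ _).trans ((min_le_right _ _).trans ((min_le_right _ _).trans ((min_le_right _ _).trans ((min_le_right _ _).trans ((min_le_right _ _).trans ((min_le_right _ _).trans ((min_le_right _ _).trans (le_rfl)))))))))))))))))))))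

/-- `A_k_nonneg` (auxiliary). [folklore] -/
theorem A_k_nonneg : (0 : ℝ) ≤ 1 := zero_le_one
/-- `B_k_pos` (auxiliary). [folklore] -/
theorem B_k_pos : (0 : ℝ) < liteKmaxGen Q.ms := liteKmaxGen_pos Q.ms_pos
/-- `bound_k_pos` (auxiliary). [folklore] -/
theorem bound_k_pos : (0 : ℝ) < 1 / (2 * (1 + (1) / (liteKmaxGen Q.ms))) := by
  have hq : (0 : ℝ) ≤ (1) / (liteKmaxGen Q.ms) := div_nonneg A_k_nonneg (Q.B_k_pos).le
  positivity
/-- `κ_D · A ≤ B / 2` for the condition `k`. [folklore] -/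
theorem half_k : Q.κD * (1) ≤ (liteKmaxGen Q.ms) / 2 :=
  mul_le_half_of_le A_k_nonneg Q.B_k_pos le_rfl Q.κD_le_bound_k

/-- `A_one_nonneg` (auxiliary). [folklore] -/
theorem A_one_nonneg : (0 : ℝ) ≤ 1 := zero_le_one
/-- `B_one_pos` (auxiliary). [folklore] -/
theorem B_one_pos : (0 : ℝ) < 1 := one_pos
/-- `bound_one_pos` (auxiliary). [folklore] -/
theorem bound_one_pos : (0 : ℝ) < 1 / (2 * (1 + (1) / (1))) := by
  have hq : (0 : ℝ) ≤ (1) / (1) := div_nonneg A_one_nonneg (B_one_pos).le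
  positivity
/-- `κ_D · A ≤ B / 2` for the condition `one`. [folklore] -/
theorem half_one : Q.κD * (1) ≤ (1) / 2 :=
  mul_le_half_of_le A_one_nonneg B_one_pos le_rfl Q.κD_le_bound_one

/-- `A_mu_nonneg` (auxiliary). [folklore] -/
theorem A_mu_nonneg : (0 : ℝ) ≤ 3 * Q.ms := by have := Q.ms_pos; positivity
/-- `B_mu_pos` (auxiliary). [folklore] -/
theorem B_mu_pos : (0 : ℝ) < Q.μ := Q.μ_pos
/-- `bound_mu_pos` (auxiliary). [folklore] -/
theorem bound_mu_pos : (0 : ℝ) < 1 / (2 * (1 + (3 * Q.ms) / (Q.μ))) := by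
  have hq : (0 : ℝ) ≤ (3 * Q.ms) / (Q.μ) := div_nonneg Q.A_mu_nonneg (Q.B_mu_pos).le
  positivity
/-- `κ_D · A ≤ B / 2` for the condition `mu`. [folklore] -/
theorem half_mu : Q.κD * (3 * Q.ms) ≤ (Q.μ) / 2 :=
  mul_le_half_of_le Q.A_mu_nonneg Q.B_mu_pos le_rfl Q.κD_le_bound_mu

/-- `A_e1_nonneg` (auxiliary). [folklore] -/
theorem A_e1_nonneg : (0 : ℝ) ≤ Q.emax := Q.emax_pos.le
/-- `B_e1_pos` (auxiliary). [folklore] -/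
theorem B_e1_pos : (0 : ℝ) < Q.emin := Q.emin_pos
/-- `bound_e1_pos` (auxiliary). [folklore] -/
theorem bound_e1_pos : (0 : ℝ) < 1 / (2 * (1 + (Q.emax) / (Q.emin))) := by
  have hq : (0 : ℝ) ≤ (Q.emax) / (Q.emin) := div_nonneg Q.A_e1_nonneg (Q.B_e1_pos).le
  positivity
/-- `κ_D · A ≤ B / 2` for the condition `e1`. [folklore] -/
theorem half_e1 : Q.κD * (Q.emax) ≤ (Q.emin) / 2 :=
  mul_le_half_of_le Q.A_e1_nonneg Q.B_e1_pos le_rfl Q.κD_le_bound_e1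

/-- `A_e2_nonneg` (auxiliary). [folklore] -/
theorem A_e2_nonneg : (0 : ℝ) ≤ Q.emax := Q.emax_pos.le
/-- `B_e2_pos` (auxiliary). [folklore] -/
theorem B_e2_pos : (0 : ℝ) < 1 := one_pos
/-- `bound_e2_pos` (auxiliary). [folklore] -/
theorem bound_e2_pos : (0 : ℝ) < 1 / (2 * (1 + (Q.emax) / (1))) := by
  have hq : (0 : ℝ) ≤ (Q.emax) / (1) := div_nonneg Q.A_e2_nonneg (B_e2_pos).le
  positivity
/-- `κ_D · A ≤ B / 2` for the condition `e2`. [folklore] -/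
theorem half_e2 : Q.κD * (Q.emax) ≤ (1) / 2 :=
  mul_le_half_of_le Q.A_e2_nonneg B_e2_pos le_rfl Q.κD_le_bound_e2

/-- `A_Mel_nonneg` (auxiliary). [folklore] -/
theorem A_Mel_nonneg : (0 : ℝ) ≤ 2 * Q.Me * c.liteMH := by have := Q.Me_nonneg; have := c.liteMH_pos; positivity
/-- `B_Mel_pos` (auxiliary). [folklore] -/
theorem B_Mel_pos : (0 : ℝ) < c.liteVmin2 Q.μ_pos * Q.emin := mul_pos (c.liteVmin2_spec Q.μ_pos).1 Q.emin_pos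
/-- `bound_Mel_pos` (auxiliary). [folklore] -/
theorem bound_Mel_pos : (0 : ℝ) < 1 / (2 * (1 + (2 * Q.Me * c.liteMH) / (c.liteVmin2 Q.μ_pos * Q.emin))) := by
  have hq : (0 : ℝ) ≤ (2 * Q.Me * c.liteMH) / (c.liteVmin2 Q.μ_pos * Q.emin) := div_nonneg Q.A_Mel_nonneg (Q.B_Mel_pos).le
  positivity
/-- `κ_D · A ≤ B / 2` for the condition `Mel`. [folklore] -/
theorem half_Mel : Q.κD * (2 * Q.Me * c.liteMH) ≤ (c.liteVmin2 Q.μ_pos * Q.emin) / 2 :=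
  mul_le_half_of_le Q.A_Mel_nonneg Q.B_Mel_pos le_rfl Q.κD_le_bound_Mel

/-- `A_Meu_nonneg` (auxiliary). [folklore] -/
theorem A_Meu_nonneg : (0 : ℝ) ≤ 2 * Q.Me * c.liteMHU := by have := Q.Me_nonneg; have := c.liteMHU_pos; positivity
/-- `B_Meu_pos` (auxiliary). [folklore] -/
theorem B_Meu_pos : (0 : ℝ) < c.liteVminU2 Q.μ_pos * Q.emin := mul_pos (c.liteVminU2_spec Q.μ_pos).1 Q.emin_pos
/-- `bound_Meu_pos` (auxiliary). [folklore] -/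
theorem bound_Meu_pos : (0 : ℝ) < 1 / (2 * (1 + (2 * Q.Me * c.liteMHU) / (c.liteVminU2 Q.μ_pos * Q.emin))) := by
  have hq : (0 : ℝ) ≤ (2 * Q.Me * c.liteMHU) / (c.liteVminU2 Q.μ_pos * Q.emin) := div_nonneg Q.A_Meu_nonneg (Q.B_Meu_pos).le
  positivity
/-- `κ_D · A ≤ B / 2` for the condition `Meu`. [folklore] -/
theorem half_Meu : Q.κD * (2 * Q.Me * c.liteMHU) ≤ (c.liteVminU2 Q.μ_pos * Q.emin) / 2 :=
  mul_le_half_of_le Q.A_Meu_nonneg Q.B_Meu_pos le_rfl Q.κD_le_bound_Meu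

/-- `A_c1l_nonneg` (auxiliary). [folklore] -/
theorem A_c1l_nonneg : (0 : ℝ) ≤ 2 * Q.Me * routeMH' c.liteMH Q.ms Q.CT Q.Mρ := by have := Q.Me_nonneg; have := Q.MH'ₗ_pos; positivity
/-- `B_c1l_pos` (auxiliary). [folklore] -/
theorem B_c1l_pos : (0 : ℝ) < c.liteVmin2 Q.μ_pos * Q.emin := mul_pos (c.liteVmin2_spec Q.μ_pos).1 Q.emin_pos
/-- `bound_c1l_pos` (auxiliary). [folklore] -/
theorem bound_c1l_pos : (0 : ℝ) < 1 / (2 * (1 + (2 * Q.Me * routeMH' c.liteMH Q.ms Q.CT Q.Mρ) / (c.liteVmin2 Q.μ_pos * Q.emin))) := by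
  have hq : (0 : ℝ) ≤ (2 * Q.Me * routeMH' c.liteMH Q.ms Q.CT Q.Mρ) / (c.liteVmin2 Q.μ_pos * Q.emin) := div_nonneg Q.A_c1l_nonneg (Q.B_c1l_pos).le
  positivity
/-- `κ_D · A ≤ B / 2` for the condition `c1l`. [folklore] -/
theorem half_c1l : Q.κD * (2 * Q.Me * routeMH' c.liteMH Q.ms Q.CT Q.Mρ) ≤ (c.liteVmin2 Q.μ_pos * Q.emin) / 2 :=
  mul_le_half_of_le Q.A_c1l_nonneg Q.B_c1l_pos le_rfl Q.κD_le_bound_c1l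

/-- `A_c1u_nonneg` (auxiliary). [folklore] -/
theorem A_c1u_nonneg : (0 : ℝ) ≤ 2 * Q.Me * routeMH' c.liteMHU Q.ms Q.CT Q.Mρ := by have := Q.Me_nonneg; have := Q.MH'ᵤ_pos; positivity
/-- `B_c1u_pos` (auxiliary). [folklore] -/
theorem B_c1u_pos : (0 : ℝ) < c.liteVminU2 Q.μ_pos * Q.emin := mul_pos (c.liteVminU2_spec Q.μ_pos).1 Q.emin_pos
/-- `bound_c1u_pos` (auxiliary). [folklore] -/
theorem bound_c1u_pos : (0 : ℝ) < 1 / (2 * (1 + (2 * Q.Me * routeMH' c.liteMHU Q.ms Q.CT Q.Mρ) / (c.liteVminU2 Q.μ_pos * Q.emin))) := by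
  have hq : (0 : ℝ) ≤ (2 * Q.Me * routeMH' c.liteMHU Q.ms Q.CT Q.Mρ) / (c.liteVminU2 Q.μ_pos * Q.emin) := div_nonneg Q.A_c1u_nonneg (Q.B_c1u_pos).le
  positivity
/-- `κ_D · A ≤ B / 2` for the condition `c1u`. [folklore] -/
theorem half_c1u : Q.κD * (2 * Q.Me * routeMH' c.liteMHU Q.ms Q.CT Q.Mρ) ≤ (c.liteVminU2 Q.μ_pos * Q.emin) / 2 :=
  mul_le_half_of_le Q.A_c1u_nonneg Q.B_c1u_pos le_rfl Q.κD_le_bound_c1u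

/-- `A_csl_nonneg` (auxiliary). [folklore] -/
theorem A_csl_nonneg : (0 : ℝ) ≤ c.cmax * Q.emax + c.qmaxc * Q.MΘ * routeMH' c.liteMH Q.ms Q.CT Q.Mρ / c.liteVmin2 Q.μ_pos := by have := c.cmax_nonneg; have := Q.emax_pos; have := c.qmaxc_pos; have := Q.MΘ_pos; have := Q.MH'ₗ_pos; have := (c.liteVmin2_spec Q.μ_pos).1; positivity
/-- `B_csl_pos` (auxiliary). [folklore] -/
theorem B_csl_pos : (0 : ℝ) < 2⁻¹ := by norm_num
/-- `bound_csl_pos` (auxiliary). [folklore] -/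
theorem bound_csl_pos : (0 : ℝ) < 1 / (2 * (1 + (c.cmax * Q.emax + c.qmaxc * Q.MΘ * routeMH' c.liteMH Q.ms Q.CT Q.Mρ / c.liteVmin2 Q.μ_pos) / (2⁻¹))) := by
  have hq : (0 : ℝ) ≤ (c.cmax * Q.emax + c.qmaxc * Q.MΘ * routeMH' c.liteMH Q.ms Q.CT Q.Mρ / c.liteVmin2 Q.μ_pos) / (2⁻¹) := div_nonneg Q.A_csl_nonneg (B_csl_pos).le
  positivity
/-- `κ_D · A ≤ B / 2` for the condition `csl`. [folklore] -/
theorem half_csl : Q.κD * (c.cmax * Q.emax + c.qmaxc * Q.MΘ * routeMH' c.liteMH Q.ms Q.CT Q.Mρ / c.liteVmin2 Q.μ_pos) ≤ (2⁻¹) / 2 :=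
  mul_le_half_of_le Q.A_csl_nonneg B_csl_pos le_rfl Q.κD_le_bound_csl

/-- `A_csu_nonneg` (auxiliary). [folklore] -/
theorem A_csu_nonneg : (0 : ℝ) ≤ c.cmax * Q.emax + c.qmaxc * Q.MΘ * routeMH' c.liteMHU Q.ms Q.CT Q.Mρ / c.liteVminU2 Q.μ_pos := by have := c.cmax_nonneg; have := Q.emax_pos; have := c.qmaxc_pos; have := Q.MΘ_pos; have := Q.MH'ᵤ_pos; have := (c.liteVminU2_spec Q.μ_pos).1; positivity
/-- `B_csu_pos` (auxiliary). [folklore] -/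
theorem B_csu_pos : (0 : ℝ) < 2⁻¹ := by norm_num
/-- `bound_csu_pos` (auxiliary). [folklore] -/
theorem bound_csu_pos : (0 : ℝ) < 1 / (2 * (1 + (c.cmax * Q.emax + c.qmaxc * Q.MΘ * routeMH' c.liteMHU Q.ms Q.CT Q.Mρ / c.liteVminU2 Q.μ_pos) / (2⁻¹))) := by
  have hq : (0 : ℝ) ≤ (c.cmax * Q.emax + c.qmaxc * Q.MΘ * routeMH' c.liteMHU Q.ms Q.CT Q.Mρ / c.liteVminU2 Q.μ_pos) / (2⁻¹) := div_nonneg Q.A_csu_nonneg (B_csu_pos).le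
  positivity
/-- `κ_D · A ≤ B / 2` for the condition `csu`. [folklore] -/
theorem half_csu : Q.κD * (c.cmax * Q.emax + c.qmaxc * Q.MΘ * routeMH' c.liteMHU Q.ms Q.CT Q.Mρ / c.liteVminU2 Q.μ_pos) ≤ (2⁻¹) / 2 :=
  mul_le_half_of_le Q.A_csu_nonneg B_csu_pos le_rfl Q.κD_le_bound_csu

/-- `A_c2l_nonneg` (auxiliary). [folklore] -/
theorem A_c2l_nonneg : (0 : ℝ) ≤ 4 * c.cmax * (c.cmax * Q.emax + c.qmaxc * Q.MΘ * routeMH' c.liteMH Q.ms Q.CT Q.Mρ / c.liteVmin2 Q.μ_pos) := by have := c.cmax_nonneg; have := Q.emax_pos; have := c.qmaxc_pos; have := Q.MΘ_pos; have := Q.MH'ₗ_pos; have := (c.liteVmin2_spec Q.μ_pos).1; positivity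
/-- `B_c2l_pos` (auxiliary). [folklore] -/
theorem B_c2l_pos : (0 : ℝ) < 1 := one_pos
/-- `bound_c2l_pos` (auxiliary). [folklore] -/
theorem bound_c2l_pos : (0 : ℝ) < 1 / (2 * (1 + (4 * c.cmax * (c.cmax * Q.emax + c.qmaxc * Q.MΘ * routeMH' c.liteMH Q.ms Q.CT Q.Mρ / c.liteVmin2 Q.μ_pos)) / (1))) := by
  have hq : (0 : ℝ) ≤ (4 * c.cmax * (c.cmax * Q.emax + c.qmaxc * Q.MΘ * routeMH' c.liteMH Q.ms Q.CT Q.Mρ / c.liteVmin2 Q.μ_pos)) / (1) := div_nonneg Q.A_c2l_nonneg (B_c2l_pos).le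
  positivity
/-- `κ_D · A ≤ B / 2` for the condition `c2l`. [folklore] -/
theorem half_c2l : Q.κD * (4 * c.cmax * (c.cmax * Q.emax + c.qmaxc * Q.MΘ * routeMH' c.liteMH Q.ms Q.CT Q.Mρ / c.liteVmin2 Q.μ_pos)) ≤ (1) / 2 :=
  mul_le_half_of_le Q.A_c2l_nonneg B_c2l_pos le_rfl Q.κD_le_bound_c2l

/-- `A_c2u_nonneg` (auxiliary). [folklore] -/
theorem A_c2u_nonneg : (0 : ℝ) ≤ 4 * c.cmax * (c.cmax * Q.emax + c.qmaxc * Q.MΘ * routeMH' c.liteMHU Q.ms Q.CT Q.Mρ / c.liteVminU2 Q.μ_pos) := by have := c.cmax_nonneg; have := Q.emax_pos; have := c.qmaxc_pos; have := Q.MΘ_pos; have := Q.MH'ᵤ_pos; have := (c.liteVminU2_spec Q.μ_pos).1; positivity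
/-- `B_c2u_pos` (auxiliary). [folklore] -/
theorem B_c2u_pos : (0 : ℝ) < 1 := one_pos
/-- `bound_c2u_pos` (auxiliary). [folklore] -/
theorem bound_c2u_pos : (0 : ℝ) < 1 / (2 * (1 + (4 * c.cmax * (c.cmax * Q.emax + c.qmaxc * Q.MΘ * routeMH' c.liteMHU Q.ms Q.CT Q.Mρ / c.liteVminU2 Q.μ_pos)) / (1))) := by
  have hq : (0 : ℝ) ≤ (4 * c.cmax * (c.cmax * Q.emax + c.qmaxc * Q.MΘ * routeMH' c.liteMHU Q.ms Q.CT Q.Mρ / c.liteVminU2 Q.μ_pos)) / (1) := div_nonneg Q.A_c2u_nonneg (B_c2u_pos).le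
  positivity
/-- `κ_D · A ≤ B / 2` for the condition `c2u`. [folklore] -/
theorem half_c2u : Q.κD * (4 * c.cmax * (c.cmax * Q.emax + c.qmaxc * Q.MΘ * routeMH' c.liteMHU Q.ms Q.CT Q.Mρ / c.liteVminU2 Q.μ_pos)) ≤ (1) / 2 :=
  mul_le_half_of_le Q.A_c2u_nonneg B_c2u_pos le_rfl Q.κD_le_bound_c2u

/-- `A_c3l_nonneg` (auxiliary). [folklore] -/
theorem A_c3l_nonneg : (0 : ℝ) ≤ 16 * (c.qmaxc * Q.MΘ * routeMH' c.liteMH Q.ms Q.CT Q.Mρ) * (c.cmax * Q.emax + c.qmaxc * Q.MΘ * routeMH' c.liteMH Q.ms Q.CT Q.Mρ / c.liteVmin2 Q.μ_pos) := by have := c.cmax_nonneg; have := Q.emax_pos; have := c.qmaxc_pos; have := Q.MΘ_pos; have := Q.MH'ₗ_pos; have := (c.liteVmin2_spec Q.μ_pos).1; positivity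
/-- `B_c3l_pos` (auxiliary). [folklore] -/
theorem B_c3l_pos : (0 : ℝ) < c.liteVmin2 Q.μ_pos * Q.emin := mul_pos (c.liteVmin2_spec Q.μ_pos).1 Q.emin_pos
/-- `bound_c3l_pos` (auxiliary). [folklore] -/
theorem bound_c3l_pos : (0 : ℝ) < 1 / (2 * (1 + (16 * (c.qmaxc * Q.MΘ * routeMH' c.liteMH Q.ms Q.CT Q.Mρ) * (c.cmax * Q.emax + c.qmaxc * Q.MΘ * routeMH' c.liteMH Q.ms Q.CT Q.Mρ / c.liteVmin2 Q.μ_pos)) / (c.liteVmin2 Q.μ_pos * Q.emin))) := by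
  have hq : (0 : ℝ) ≤ (16 * (c.qmaxc * Q.MΘ * routeMH' c.liteMH Q.ms Q.CT Q.Mρ) * (c.cmax * Q.emax + c.qmaxc * Q.MΘ * routeMH' c.liteMH Q.ms Q.CT Q.Mρ / c.liteVmin2 Q.μ_pos)) / (c.liteVmin2 Q.μ_pos * Q.emin) := div_nonneg Q.A_c3l_nonneg (Q.B_c3l_pos).le
  positivity
/-- `κ_D · A ≤ B / 2` for the condition `c3l`. [folklore] -/
theorem half_c3l : Q.κD * (16 * (c.qmaxc * Q.MΘ * routeMH' c.liteMH Q.ms Q.CT Q.Mρ) * (c.cmax * Q.emax + c.qmaxc * Q.MΘ * routeMH' c.liteMH Q.ms Q.CT Q.Mρ / c.liteVmin2 Q.μ_pos)) ≤ (c.liteVmin2 Q.μ_pos * Q.emin) / 2 :=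
  mul_le_half_of_le Q.A_c3l_nonneg Q.B_c3l_pos le_rfl Q.κD_le_bound_c3l

/-- `A_c3u_nonneg` (auxiliary). [folklore] -/
theorem A_c3u_nonneg : (0 : ℝ) ≤ 16 * (c.qmaxc * Q.MΘ * routeMH' c.liteMHU Q.ms Q.CT Q.Mρ) * (c.cmax * Q.emax + c.qmaxc * Q.MΘ * routeMH' c.liteMHU Q.ms Q.CT Q.Mρ / c.liteVminU2 Q.μ_pos) := by have := c.cmax_nonneg; have := Q.emax_pos; have := c.qmaxc_pos; have := Q.MΘ_pos; have := Q.MH'ᵤ_pos; have := (c.liteVminU2_spec Q.μ_pos).1; positivity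
/-- `B_c3u_pos` (auxiliary). [folklore] -/
theorem B_c3u_pos : (0 : ℝ) < c.liteVminU2 Q.μ_pos * Q.emin := mul_pos (c.liteVminU2_spec Q.μ_pos).1 Q.emin_pos
/-- `bound_c3u_pos` (auxiliary). [folklore] -/
theorem bound_c3u_pos : (0 : ℝ) < 1 / (2 * (1 + (16 * (c.qmaxc * Q.MΘ * routeMH' c.liteMHU Q.ms Q.CT Q.Mρ) * (c.cmax * Q.emax + c.qmaxc * Q.MΘ * routeMH' c.liteMHU Q.ms Q.CT Q.Mρ / c.liteVminU2 Q.μ_pos)) / (c.liteVminU2 Q.μ_pos * Q.emin))) := by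
  have hq : (0 : ℝ) ≤ (16 * (c.qmaxc * Q.MΘ * routeMH' c.liteMHU Q.ms Q.CT Q.Mρ) * (c.cmax * Q.emax + c.qmaxc * Q.MΘ * routeMH' c.liteMHU Q.ms Q.CT Q.Mρ / c.liteVminU2 Q.μ_pos)) / (c.liteVminU2 Q.μ_pos * Q.emin) := div_nonneg Q.A_c3u_nonneg (Q.B_c3u_pos).le
  positivity
/-- `κ_D · A ≤ B / 2` for the condition `c3u`. [folklore] -/
theorem half_c3u : Q.κD * (16 * (c.qmaxc * Q.MΘ * routeMH' c.liteMHU Q.ms Q.CT Q.Mρ) * (c.cmax * Q.emax + c.qmaxc * Q.MΘ * routeMH' c.liteMHU Q.ms Q.CT Q.Mρ / c.liteVminU2 Q.μ_pos)) ≤ (c.liteVminU2 Q.μ_pos * Q.emin) / 2 :=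
  mul_le_half_of_le Q.A_c3u_nonneg Q.B_c3u_pos le_rfl Q.κD_le_bound_c3u

/-- `A_fA_nonneg` (auxiliary). [folklore] -/
theorem A_fA_nonneg : (0 : ℝ) ≤ Q.MΘ * (Q.emin / (4 * (Q.Mρ * Q.emax + Q.Me)) + 2 * c.cmax * Q.emax / (c.qminc * Q.mΘ)) := mul_nonneg Q.MΘ_pos.le Q.Z_nonneg
/-- `B_fA_pos` (auxiliary). [folklore] -/
theorem B_fA_pos : (0 : ℝ) < c.θlow / 2 := by linarith [c.θlow_pos]
/-- `bound_fA_pos` (auxiliary). [folklore] -/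
theorem bound_fA_pos : (0 : ℝ) < 1 / (2 * (1 + (Q.MΘ * (Q.emin / (4 * (Q.Mρ * Q.emax + Q.Me)) + 2 * c.cmax * Q.emax / (c.qminc * Q.mΘ))) / (c.θlow / 2))) := by
  have hq : (0 : ℝ) ≤ (Q.MΘ * (Q.emin / (4 * (Q.Mρ * Q.emax + Q.Me)) + 2 * c.cmax * Q.emax / (c.qminc * Q.mΘ))) / (c.θlow / 2) := div_nonneg Q.A_fA_nonneg (B_fA_pos).le
  positivity
/-- `κ_D · A ≤ B / 2` for the condition `fA`. [folklore] -/
theorem half_fA : Q.κD * (Q.MΘ * (Q.emin / (4 * (Q.Mρ * Q.emax + Q.Me)) + 2 * c.cmax * Q.emax / (c.qminc * Q.mΘ))) ≤ (c.θlow / 2) / 2 :=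
  mul_le_half_of_le Q.A_fA_nonneg B_fA_pos le_rfl Q.κD_le_bound_fA

/-- `A_fB_nonneg` (auxiliary). [folklore] -/
theorem A_fB_nonneg : (0 : ℝ) ≤ 2 * Q.MΘ * Q.emax := by have := Q.MΘ_pos; have := Q.emax_pos; positivity
/-- `B_fB_pos` (auxiliary). [folklore] -/
theorem B_fB_pos : (0 : ℝ) < Q.lam * c.θlow := mul_pos Q.lam_pos c.θlow_pos
/-- `bound_fB_pos` (auxiliary). [folklore] -/
theorem bound_fB_pos : (0 : ℝ) < 1 / (2 * (1 + (2 * Q.MΘ * Q.emax) / (Q.lam * c.θlow))) := by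
  have hq : (0 : ℝ) ≤ (2 * Q.MΘ * Q.emax) / (Q.lam * c.θlow) := div_nonneg Q.A_fB_nonneg (Q.B_fB_pos).le
  positivity
/-- `κ_D · A ≤ B / 2` for the condition `fB`. [folklore] -/
theorem half_fB : Q.κD * (2 * Q.MΘ * Q.emax) ≤ (Q.lam * c.θlow) / 2 :=
  mul_le_half_of_le Q.A_fB_nonneg Q.B_fB_pos le_rfl Q.κD_le_bound_fB

/-- `A_fM_nonneg` (auxiliary). [folklore] -/
theorem A_fM_nonneg : (0 : ℝ) ≤ 20 * Q.emax := by have := Q.emax_pos; positivity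
/-- `B_fM_pos` (auxiliary). [folklore] -/
theorem B_fM_pos : (0 : ℝ) < Q.lam := Q.lam_pos
/-- `bound_fM_pos` (auxiliary). [folklore] -/
theorem bound_fM_pos : (0 : ℝ) < 1 / (2 * (1 + (20 * Q.emax) / (Q.lam))) := by
  have hq : (0 : ℝ) ≤ (20 * Q.emax) / (Q.lam) := div_nonneg Q.A_fM_nonneg (Q.B_fM_pos).le
  positivity
/-- `κ_D · A ≤ B / 2` for the condition `fM`. [folklore] -/
theorem half_fM : Q.κD * (20 * Q.emax) ≤ (Q.lam) / 2 :=
  mul_le_half_of_le Q.A_fM_nonneg Q.B_fM_pos le_rfl Q.κD_le_bound_fM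

/-- `A_bs_nonneg` (auxiliary). [folklore] -/
theorem A_bs_nonneg : (0 : ℝ) ≤ Q.emin / (4 * (Q.Mρ * Q.emax + Q.Me)) := by have := Q.emin_pos; have := Q.smax_pos; positivity
/-- `B_bs_pos` (auxiliary). [folklore] -/
theorem B_bs_pos : (0 : ℝ) < 100⁻¹ := by norm_num
/-- `bound_bs_pos` (auxiliary). [folklore] -/
theorem bound_bs_pos : (0 : ℝ) < 1 / (2 * (1 + (Q.emin / (4 * (Q.Mρ * Q.emax + Q.Me))) / (100⁻¹))) := by
  have hq : (0 : ℝ) ≤ (Q.emin / (4 * (Q.Mρ * Q.emax + Q.Me))) / (100⁻¹) := div_nonneg Q.A_bs_nonneg (B_bs_pos).le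
  positivity
/-- `κ_D · A ≤ B / 2` for the condition `bs`. [folklore] -/
theorem half_bs : Q.κD * (Q.emin / (4 * (Q.Mρ * Q.emax + Q.Me))) ≤ (100⁻¹) / 2 :=
  mul_le_half_of_le Q.A_bs_nonneg B_bs_pos le_rfl Q.κD_le_bound_bs

/-- `A_F1_nonneg` (auxiliary). [folklore] -/
theorem A_F1_nonneg : (0 : ℝ) ≤ c.cmax * Q.emax + c.QF * Q.MΘ * (Q.emin / (4 * (Q.Mρ * Q.emax + Q.Me)) + 2 * c.cmax * Q.emax / (c.qminc * Q.mΘ)) := by have := c.cmax_nonneg; have := Q.emax_pos; have := c.QF_pos; have := Q.MΘ_pos; have := Q.Z_nonneg; positivity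
/-- `B_F1_pos` (auxiliary). [folklore] -/
theorem B_F1_pos : (0 : ℝ) < 2⁻¹ := by norm_num
/-- `bound_F1_pos` (auxiliary). [folklore] -/
theorem bound_F1_pos : (0 : ℝ) < 1 / (2 * (1 + (c.cmax * Q.emax + c.QF * Q.MΘ * (Q.emin / (4 * (Q.Mρ * Q.emax + Q.Me)) + 2 * c.cmax * Q.emax / (c.qminc * Q.mΘ))) / (2⁻¹))) := by
  have hq : (0 : ℝ) ≤ (c.cmax * Q.emax + c.QF * Q.MΘ * (Q.emin / (4 * (Q.Mρ * Q.emax + Q.Me)) + 2 * c.cmax * Q.emax / (c.qminc * Q.mΘ))) / (2⁻¹) := div_nonneg Q.A_F1_nonneg (B_F1_pos).le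
  positivity
/-- `κ_D · A ≤ B / 2` for the condition `F1`. [folklore] -/
theorem half_F1 : Q.κD * (c.cmax * Q.emax + c.QF * Q.MΘ * (Q.emin / (4 * (Q.Mρ * Q.emax + Q.Me)) + 2 * c.cmax * Q.emax / (c.qminc * Q.mΘ))) ≤ (2⁻¹) / 2 :=
  mul_le_half_of_le Q.A_F1_nonneg B_F1_pos le_rfl Q.κD_le_bound_F1

/-- `A_F1p_nonneg` (auxiliary). [folklore] -/
theorem A_F1p_nonneg : (0 : ℝ) ≤ 8 * c.cmax * (c.cmax * Q.emax + c.QF * Q.MΘ * (Q.emin / (4 * (Q.Mρ * Q.emax + Q.Me)) + 2 * c.cmax * Q.emax / (c.qminc * Q.mΘ))) := by have := c.cmax_nonneg; have := Q.emax_pos; have := c.QF_pos; have := Q.MΘ_pos; have := Q.Z_nonneg; positivity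
/-- `B_F1p_pos` (auxiliary). [folklore] -/
theorem B_F1p_pos : (0 : ℝ) < 1 := one_pos
/-- `bound_F1p_pos` (auxiliary). [folklore] -/
theorem bound_F1p_pos : (0 : ℝ) < 1 / (2 * (1 + (8 * c.cmax * (c.cmax * Q.emax + c.QF * Q.MΘ * (Q.emin / (4 * (Q.Mρ * Q.emax + Q.Me)) + 2 * c.cmax * Q.emax / (c.qminc * Q.mΘ)))) / (1))) := by
  have hq : (0 : ℝ) ≤ (8 * c.cmax * (c.cmax * Q.emax + c.QF * Q.MΘ * (Q.emin / (4 * (Q.Mρ * Q.emax + Q.Me)) + 2 * c.cmax * Q.emax / (c.qminc * Q.mΘ)))) / (1) := div_nonneg Q.A_F1p_nonneg (B_F1p_pos).le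
  positivity
/-- `κ_D · A ≤ B / 2` for the condition `F1p`. [folklore] -/
theorem half_F1p : Q.κD * (8 * c.cmax * (c.cmax * Q.emax + c.QF * Q.MΘ * (Q.emin / (4 * (Q.Mρ * Q.emax + Q.Me)) + 2 * c.cmax * Q.emax / (c.qminc * Q.mΘ)))) ≤ (1) / 2 :=
  mul_le_half_of_le Q.A_F1p_nonneg B_F1p_pos le_rfl Q.κD_le_bound_F1p

/-- `A_F2_nonneg` (auxiliary). [folklore] -/
theorem A_F2_nonneg : (0 : ℝ) ≤ 16 * (c.QF * Q.MΘ) * (c.cmax * Q.emax + c.QF * Q.MΘ * (Q.emin / (4 * (Q.Mρ * Q.emax + Q.Me)) + 2 * c.cmax * Q.emax / (c.qminc * Q.mΘ))) := by have := c.cmax_nonneg; have := Q.emax_pos; have := c.QF_pos; have := Q.MΘ_pos; have := Q.Z_nonneg; positivity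
/-- `B_F2_pos` (auxiliary). [folklore] -/
theorem B_F2_pos : (0 : ℝ) < Q.lam := Q.lam_pos
/-- `bound_F2_pos` (auxiliary). [folklore] -/
theorem bound_F2_pos : (0 : ℝ) < 1 / (2 * (1 + (16 * (c.QF * Q.MΘ) * (c.cmax * Q.emax + c.QF * Q.MΘ * (Q.emin / (4 * (Q.Mρ * Q.emax + Q.Me)) + 2 * c.cmax * Q.emax / (c.qminc * Q.mΘ)))) / (Q.lam))) := by
  have hq : (0 : ℝ) ≤ (16 * (c.QF * Q.MΘ) * (c.cmax * Q.emax + c.QF * Q.MΘ * (Q.emin / (4 * (Q.Mρ * Q.emax + Q.Me)) + 2 * c.cmax * Q.emax / (c.qminc * Q.mΘ)))) / (Q.lam) := div_nonneg Q.A_F2_nonneg (Q.B_F2_pos).le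
  positivity
/-- `κ_D · A ≤ B / 2` for the condition `F2`. [folklore] -/
theorem half_F2 : Q.κD * (16 * (c.QF * Q.MΘ) * (c.cmax * Q.emax + c.QF * Q.MΘ * (Q.emin / (4 * (Q.Mρ * Q.emax + Q.Me)) + 2 * c.cmax * Q.emax / (c.qminc * Q.mΘ)))) ≤ (Q.lam) / 2 :=
  mul_le_half_of_le Q.A_F2_nonneg Q.B_F2_pos le_rfl Q.κD_le_bound_F2

/-- `κD_pos` (auxiliary). [folklore] -/
theorem κD_pos : 0 < Q.κD := by
  rw [κD_def]
  exact lt_min Q.bound_k_pos (lt_min bound_one_pos (lt_min Q.bound_mu_pos (lt_min Q.bound_e1_pos (lt_min Q.bound_e2_pos (lt_min Q.bound_Mel_pos (lt_min Q.bound_Meu_pos (lt_min Q.bound_c1l_pos (lt_min Q.bound_c1u_pos (lt_min Q.bound_csl_pos (lt_min Q.bound_csu_pos (lt_min Q.bound_c2l_pos (lt_min Q.bound_c2u_pos (lt_min Q.bound_c3l_pos (lt_min Q.bound_c3u_pos (lt_min Q.bound_fA_pos (lt_min Q.bound_fB_pos (lt_min Q.bound_fM_pos (lt_min Q.bound_bs_pos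 (lt_min Q.bound_F1_pos (lt_min Q.bound_F1p_pos (Q.bound_F2_pos)))))))))))))))))))))

/-- `κD_le_one_half` (auxiliary). [folklore] -/
theorem κD_le_one_half : Q.κD ≤ 2⁻¹ := by have := Q.half_one; linarith
/-- `κD_le_one` (auxiliary). [folklore] -/
theorem κD_le_one : Q.κD ≤ 1 := by linarith [Q.κD_le_one_half]

/-- **Stage B: the full parameter record.** [cite: Kirby1989, Ch. I §4] -/
def toSlideChoice : c.SlideChoice e where
  CT := Q.CT
  CT_ge := Q.CT_ge
  CT_nonneg := Q.CT_nonneg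
  emin := Q.emin
  emax := Q.emax
  Me := Q.Me
  emin_pos := Q.emin_pos
  e_bounds := Q.e_bounds
  e_deriv := Q.e_deriv
  mΘ := Q.mΘ
  MΘ := Q.MΘ
  mΘ_pos := Q.mΘ_pos
  Θ_deriv := Q.Θ_deriv
  μ := Q.μ
  μ_pos := Q.μ_pos
  μ_le := Q.μ_le
  μ_angle := Q.μ_angle
  Mρ := Q.Mρ
  Mρ_pos := Q.Mρ_pos
  Mρ_geₗ := Q.Mρ_geₗ
  Mρ_geᵤ := Q.Mρ_geᵤ
  ms := Q.ms
  ms_geₗ := Q.ms_geₗ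
  ms_geᵤ := Q.ms_geᵤ
  N := Q.N
  N_ge := Q.N_ge
  lam := Q.lam
  lam_pos := Q.lam_pos
  lam_leₗ := Q.lam_leₗ
  lam_leᵤ := Q.lam_leᵤ
  lam_gentle := Q.lam_gentle
  lam_clamp := Q.lam_clamp
  κD := Q.κD
  κD_pos := Q.κD_pos
  κD_leₖ := by have h := Q.half_k; have := liteKmaxGen_pos Q.ms_pos; linarith
  κD_μ := by have h := Q.half_mu; have := Q.μ_pos; linarith
  κD_e := by have h := Q.half_e1; have := Q.emin_pos; linarith
  κD_e' := by have h := Q.half_e2; linarith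
  κD_Meₗ := by have h := Q.half_Mel; have := Q.B_Mel_pos; linarith
  κD_Meᵤ := by have h := Q.half_Meu; have := Q.B_Meu_pos; linarith
  cond1ₗ := by have h := Q.half_c1l; have := Q.B_c1l_pos; linarith
  cond_sₗ := by
    have h := Q.half_csl
    have e1 : c.cmax * Q.κD * Q.emax + c.qmaxc * Q.MΘ * routeMH' c.liteMH Q.ms Q.CT Q.Mρ * Q.κD / c.liteVmin2 Q.μ_pos =
        Q.κD * (c.cmax * Q.emax + c.qmaxc * Q.MΘ * routeMH' c.liteMH Q.ms Q.CT Q.Mρ / c.liteVmin2 Q.μ_pos) := by ring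
    rw [e1]; linarith
  cond2ₗ := by
    have h := Q.half_c2l
    have e1 : 4 * c.cmax * (c.cmax * Q.κD * Q.emax + c.qmaxc * Q.MΘ * routeMH' c.liteMH Q.ms Q.CT Q.Mρ * Q.κD / c.liteVmin2 Q.μ_pos) =
        Q.κD * (4 * c.cmax * (c.cmax * Q.emax + c.qmaxc * Q.MΘ * routeMH' c.liteMH Q.ms Q.CT Q.Mρ / c.liteVmin2 Q.μ_pos)) := by ring
    rw [e1]; linarith
  cond3ₗ := by
    have h := Q.half_c3l
    have hB := Q.B_c3l_pos
    have e1 : 16 * (c.qmaxc * Q.MΘ * routeMH' c.liteMH Q.ms Q.CT Q.Mρ) *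
        (c.cmax * Q.κD * Q.emax + c.qmaxc * Q.MΘ * routeMH' c.liteMH Q.ms Q.CT Q.Mρ * Q.κD / c.liteVmin2 Q.μ_pos) =
        Q.κD * (16 * (c.qmaxc * Q.MΘ * routeMH' c.liteMH Q.ms Q.CT Q.Mρ) *
          (c.cmax * Q.emax + c.qmaxc * Q.MΘ * routeMH' c.liteMH Q.ms Q.CT Q.Mρ / c.liteVmin2 Q.μ_pos)) := by ring
    rw [e1]; linarith
  cond5ₗ := by
    -- `κD/N · L₁(κD) + cmax κD e₊ ≤ κD (L₁/N + cmax e₊) < κD (1 + cmax e₊) ≤ κD q₋ mΘ ms / 8`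
    have hκ := Q.κD_pos; have hκ1 := Q.κD_le_one
    have hN := Q.Nₗ; have hcl := Q.climb; have hNpos := Q.N_pos
    have hv := (c.liteVmin2_spec Q.μ_pos).1
    have hMH := Q.MH'ₗ_pos
    set L1 := c.cmax * Q.emax + c.cmax * 1 * Q.Me * routeMH' c.liteMH Q.ms Q.CT Q.Mρ / c.liteVmin2 Q.μ_pos +
      c.qmaxc * Q.MΘ * routeMH' c.liteMH Q.ms Q.CT Q.Mρ / c.liteVmin2 Q.μ_pos with hL1
    have hX : c.cmax * Q.emax + c.cmax * Q.κD * Q.Me * routeMH' c.liteMH Q.ms Q.CT Q.Mρ / c.liteVmin2 Q.μ_pos +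
        c.qmaxc * Q.MΘ * routeMH' c.liteMH Q.ms Q.CT Q.Mρ / c.liteVmin2 Q.μ_pos ≤ L1 := by
      rw [hL1]
      have : c.cmax * Q.κD * Q.Me * routeMH' c.liteMH Q.ms Q.CT Q.Mρ / c.liteVmin2 Q.μ_pos ≤
          c.cmax * 1 * Q.Me * routeMH' c.liteMH Q.ms Q.CT Q.Mρ / c.liteVmin2 Q.μ_pos := by
        apply div_le_div_of_nonneg_right _ hv.le
        have := c.cmax_nonneg; have := Q.Me_nonneg
        exact mul_le_mul_of_nonneg_right (mul_le_mul_of_nonneg_right (mul_le_mul_of_nonneg_left hκ1 c.cmax_nonneg) Q.Me_nonneg) hMH.le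
      linarith
    have h1 : Q.κD / Q.N * (c.cmax * Q.emax + c.cmax * Q.κD * Q.Me * routeMH' c.liteMH Q.ms Q.CT Q.Mρ / c.liteVmin2 Q.μ_pos +
        c.qmaxc * Q.MΘ * routeMH' c.liteMH Q.ms Q.CT Q.Mρ / c.liteVmin2 Q.μ_pos) ≤ Q.κD * (L1 / Q.N) := by
      have := mul_le_mul_of_nonneg_left hX (div_nonneg hκ.le hNpos.le)
      calc _ ≤ Q.κD / Q.N * L1 := this
        _ = Q.κD * (L1 / Q.N) := by ring
    have h2 : Q.κD * (L1 / Q.N) < Q.κD * 1 := mul_lt_mul_of_pos_left hN hκ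
    have h3 : Q.κD * (c.cmax * Q.emax + 1) ≤ Q.κD * (c.qminc * Q.mΘ * Q.ms / 8) := mul_le_mul_of_nonneg_left hcl hκ.le
    nlinarith
  cond1ᵤ := by have h := Q.half_c1u; have := Q.B_c1u_pos; linarith
  cond_sᵤ := by
    have h := Q.half_csu
    have e1 : c.cmax * Q.κD * Q.emax + c.qmaxc * Q.MΘ * routeMH' c.liteMHU Q.ms Q.CT Q.Mρ * Q.κD / c.liteVminU2 Q.μ_pos =
        Q.κD * (c.cmax * Q.emax + c.qmaxc * Q.MΘ * routeMH' c.liteMHU Q.ms Q.CT Q.Mρ / c.liteVminU2 Q.μ_pos) := by ring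
    rw [e1]; linarith
  cond2ᵤ := by
    have h := Q.half_c2u
    have e1 : 4 * c.cmax * (c.cmax * Q.κD * Q.emax + c.qmaxc * Q.MΘ * routeMH' c.liteMHU Q.ms Q.CT Q.Mρ * Q.κD / c.liteVminU2 Q.μ_pos) =
        Q.κD * (4 * c.cmax * (c.cmax * Q.emax + c.qmaxc * Q.MΘ * routeMH' c.liteMHU Q.ms Q.CT Q.Mρ / c.liteVminU2 Q.μ_pos)) := by ring
    rw [e1]; linarith
  cond3ᵤ := by
    have h := Q.half_c3u
    have hB := Q.B_c3u_pos
    have e1 : 16 * (c.qmaxc * Q.MΘ * routeMH' c.liteMHU Q.ms Q.CT Q.Mρ) *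
        (c.cmax * Q.κD * Q.emax + c.qmaxc * Q.MΘ * routeMH' c.liteMHU Q.ms Q.CT Q.Mρ * Q.κD / c.liteVminU2 Q.μ_pos) =
        Q.κD * (16 * (c.qmaxc * Q.MΘ * routeMH' c.liteMHU Q.ms Q.CT Q.Mρ) *
          (c.cmax * Q.emax + c.qmaxc * Q.MΘ * routeMH' c.liteMHU Q.ms Q.CT Q.Mρ / c.liteVminU2 Q.μ_pos)) := by ring
    rw [e1]; linarith
  cond5ᵤ := by
    have hκ := Q.κD_pos; have hκ1 := Q.κD_le_one
    have hN := Q.Nᵤ; have hcl := Q.climb; have hNpos := Q.N_pos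
    have hv := (c.liteVminU2_spec Q.μ_pos).1
    have hMH := Q.MH'ᵤ_pos
    set L1 := c.cmax * Q.emax + c.cmax * 1 * Q.Me * routeMH' c.liteMHU Q.ms Q.CT Q.Mρ / c.liteVminU2 Q.μ_pos +
      c.qmaxc * Q.MΘ * routeMH' c.liteMHU Q.ms Q.CT Q.Mρ / c.liteVminU2 Q.μ_pos with hL1
    have hX : c.cmax * Q.emax + c.cmax * Q.κD * Q.Me * routeMH' c.liteMHU Q.ms Q.CT Q.Mρ / c.liteVminU2 Q.μ_pos +
        c.qmaxc * Q.MΘ * routeMH' c.liteMHU Q.ms Q.CT Q.Mρ / c.liteVminU2 Q.μ_pos ≤ L1 := by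
      rw [hL1]
      have : c.cmax * Q.κD * Q.Me * routeMH' c.liteMHU Q.ms Q.CT Q.Mρ / c.liteVminU2 Q.μ_pos ≤
          c.cmax * 1 * Q.Me * routeMH' c.liteMHU Q.ms Q.CT Q.Mρ / c.liteVminU2 Q.μ_pos := by
        apply div_le_div_of_nonneg_right _ hv.le
        exact mul_le_mul_of_nonneg_right (mul_le_mul_of_nonneg_right (mul_le_mul_of_nonneg_left hκ1 c.cmax_nonneg) Q.Me_nonneg) hMH.le
      linarith
    have h1 : Q.κD / Q.N * (c.cmax * Q.emax + c.cmax * Q.κD * Q.Me * routeMH' c.liteMHU Q.ms Q.CT Q.Mρ / c.liteVminU2 Q.μ_pos +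
        c.qmaxc * Q.MΘ * routeMH' c.liteMHU Q.ms Q.CT Q.Mρ / c.liteVminU2 Q.μ_pos) ≤ Q.κD * (L1 / Q.N) := by
      have := mul_le_mul_of_nonneg_left hX (div_nonneg hκ.le hNpos.le)
      calc _ ≤ Q.κD / Q.N * L1 := this
        _ = Q.κD * (L1 / Q.N) := by ring
    have h2 : Q.κD * (L1 / Q.N) < Q.κD * 1 := mul_lt_mul_of_pos_left hN hκ
    have h3 : Q.κD * (c.cmax * Q.emax + 1) ≤ Q.κD * (c.qminc * Q.mΘ * Q.ms / 8) := mul_le_mul_of_nonneg_left hcl hκ.le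
    nlinarith
  fingerA := by
    have h := Q.half_fA
    have e1 : Q.MΘ * (Q.κD * Q.emin / (4 * (Q.Mρ * Q.emax + Q.Me)) + 2 * c.cmax * Q.κD * Q.emax / (c.qminc * Q.mΘ)) =
        Q.κD * (Q.MΘ * (Q.emin / (4 * (Q.Mρ * Q.emax + Q.Me)) + 2 * c.cmax * Q.emax / (c.qminc * Q.mΘ))) := by ring
    rw [e1]; linarith [c.θlow_pos]
  fingerB := by have h := Q.half_fB; have := Q.B_fB_pos; linarith
  fingerMeet := by have h := Q.half_fM; have := Q.lam_pos; linarith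
  β_small := by
    have h := Q.half_bs
    have e1 : Q.κD * Q.emin / (4 * (Q.Mρ * Q.emax + Q.Me)) = Q.κD * (Q.emin / (4 * (Q.Mρ * Q.emax + Q.Me))) := by ring
    rw [e1]; linarith
  condF1c := by
    have h := Q.half_F1
    have e1 : c.cmax * Q.κD * Q.emax + c.QF * Q.MΘ * (Q.κD * Q.emin / (4 * (Q.Mρ * Q.emax + Q.Me)) + 2 * c.cmax * Q.κD * Q.emax / (c.qminc * Q.mΘ)) =
        Q.κD * (c.cmax * Q.emax + c.QF * Q.MΘ * (Q.emin / (4 * (Q.Mρ * Q.emax + Q.Me)) + 2 * c.cmax * Q.emax / (c.qminc * Q.mΘ))) := by ring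
    rw [e1]; linarith
  condF1c' := by
    have h := Q.half_F1p
    have e1 : 8 * c.cmax * (c.cmax * Q.κD * Q.emax +
        c.QF * Q.MΘ * (Q.κD * Q.emin / (4 * (Q.Mρ * Q.emax + Q.Me)) + 2 * c.cmax * Q.κD * Q.emax / (c.qminc * Q.mΘ))) =
        Q.κD * (8 * c.cmax * (c.cmax * Q.emax +
          c.QF * Q.MΘ * (Q.emin / (4 * (Q.Mρ * Q.emax + Q.Me)) + 2 * c.cmax * Q.emax / (c.qminc * Q.mΘ)))) := by ring
    rw [e1]; linarith
  condF2c := by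
    have h := Q.half_F2
    have hl := Q.lam_pos
    have e1 : 16 * (c.QF * Q.MΘ) * (c.cmax * Q.κD * Q.emax +
        c.QF * Q.MΘ * (Q.κD * Q.emin / (4 * (Q.Mρ * Q.emax + Q.Me)) + 2 * c.cmax * Q.κD * Q.emax / (c.qminc * Q.mΘ))) =
        Q.κD * (16 * (c.QF * Q.MΘ) * (c.cmax * Q.emax +
          c.QF * Q.MΘ * (Q.emin / (4 * (Q.Mρ * Q.emax + Q.Me)) + 2 * c.cmax * Q.emax / (c.qminc * Q.mΘ)))) := by ring
    rw [e1]; linarith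

end PreChoice

/-- **Existence of the parameter record of a slide.** [cite: Kirby1989, Ch. I §4] -/
theorem exists_slideChoice {e : ℝ → ℝ} (he : ContDiffOn ℝ ∞ e (Ioo (10⁻¹ : ℝ) (9 / 10)))
    (hpos : ∀ h ∈ Ioo (10⁻¹ : ℝ) (9 / 10), 0 < e h) : Nonempty (c.SlideChoice e) := by
  obtain ⟨Q⟩ := c.exists_preChoice he hpos
  exact ⟨Q.toSlideChoice⟩

end BandCore

end Literature.Topology.FourManifolds
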